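import Summits.ValiantsHypothesis.ValiantsHypothesis.Theorems.LacunarySymmetroidMatrixDescartesFiniteSectorRankOneRung
import Summits.ValiantsHypothesis.ValiantsHypothesis.Theorems.LacunarySymmetroidMatrixDescartesFiniteSectorStampCeilingKThreeAll
import Summits.ValiantsHypothesis.ValiantsHypothesis.Theorems.LacunarySymmetroidMatrixDescartesFiniteSectorRealisableKThree

/-!
# `MatrixDescartes` — line «finite» / «stamp»: the small rows of the `K = 3` stamp column EXACT BY NAME,
# `ν(1,3) = 2`, `ν(2,3) = 4`, `ν(3,3) = 7`, `ν(4,3) = 10`, `ν(5,3) = 14`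

HONEST FRAMING.  Object-search cell `pub-symmetroid`, seat val-sym-eng-3 g10.  HELPER of the crux item `stmt-ValiantsHypothesis-18050`
(`Theses.LacunarySymmetroid.MatrixDescartes`, asymptotic in `K`) with NO closure claim.  Pure bookkeeping: the tree already holds the
`K = 3` stamp ceiling for every size (`stampLawAt_K_three : StampLawAt m 3 ⌊(m²+6m+1)/4⌋`, Stöhr's `n(m,2)`), the floors `ν(m,3) ≥ 2m`
for every `m` (`not_stampLawAt_rankOneRung`, the all-`m` rank-one rung of `…FiniteSectorRankOneRung`) and the realisations
`fullyRealisable_three_013_seven`, `fullyRealisable_four_013_ten` (`…FiniteSectorRealisable`), `fullyRealisable_five_014_fourteen`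
(`…FiniteSectorRealisableKThree`), and the rows `m = 6, …, 11` by name (`nu_six_three_exact`, …, `nu_eleven_three_exact`).  This file
names the five missing small rows in the same `ceiling ∧ ¬(ceiling − 1)` shape, so that the column `ν(m,3) = n(m,2)` is EXACT BY NAME for
every `1 ≤ m ≤ 11`; for `m = 1, 2` the floor IS the rank-one rung (`2m = n(m,2)`).  Nothing here bears on the crux or on `VP ≠ VNP`.
[folklore] Elementary bookkeeping; no citation is load-bearing.
-/

-- `Summit.ValiantsHypothesis.ValiantsHypothesis.…` repeats a component by the D-0017 layout
-- (single-conjunct summit), which the `dupNamespace` linter flags; the name is mandated.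
set_option linter.dupNamespace false

namespace Summit.ValiantsHypothesis.ValiantsHypothesis.Theorems.LacunarySymmetroidMatrixDescartes.FiniteSector

/-- **`ν(1,3) = 2` EXACT**: `StampLawAt 1 3 2 ∧ ¬ StampLawAt 1 3 1` (ceiling `stampLawAt_K_three 1`, floor the rank-one rung at `m = 1`,
a `1 × 1` pencil `μ(t − 1) + γ t²` with two positive zeros). [folklore] -/
theorem nu_one_three_exact : StampLawAt 1 3 2 ∧ ¬ StampLawAt 1 3 1 :=
  ⟨by simpa using stampLawAt_K_three 1 le_rfl, by simpa using not_stampLawAt_rankOneRung 1 le_rfl⟩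

/-- **`ν(2,3) = 4` EXACT**: `StampLawAt 2 3 4 ∧ ¬ StampLawAt 2 3 3` (ceiling `stampLawAt_two_three`, floor the rank-one rung at `m = 2`
on `(0,1,3)`; the tree's `fullyRealisable_two_013_4` is another witness). [folklore] -/
theorem nu_two_three_exact : StampLawAt 2 3 4 ∧ ¬ StampLawAt 2 3 3 :=
  ⟨stampLawAt_two_three, by simpa using not_stampLawAt_rankOneRung 2 (by norm_num)⟩

/-- **`ν(3,3) = 7` EXACT**: `StampLawAt 3 3 7 ∧ ¬ StampLawAt 3 3 6` (ceiling `stampLawAt_three_three`, floor `fullyRealisable_three_013_seven`).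
[folklore] -/
theorem nu_three_three_exact : StampLawAt 3 3 7 ∧ ¬ StampLawAt 3 3 6 := by
  refine ⟨stampLawAt_three_three, fun h => ?_⟩
  obtain ⟨S, hS, hfull, hdeg⟩ := fullyRealisable_three_013_seven
  have := h _ S hS hfull
  omega

/-- **`ν(4,3) = 10` EXACT**: `StampLawAt 4 3 10 ∧ ¬ StampLawAt 4 3 9` (ceiling `stampLawAt_four_three`, floor `fullyRealisable_four_013_ten`).
[folklore] -/
theorem nu_four_three_exact : StampLawAt 4 3 10 ∧ ¬ StampLawAt 4 3 9 := by
  refine ⟨stampLawAt_four_three, fun h => ?_⟩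
  obtain ⟨S, hS, hfull, hdeg⟩ := fullyRealisable_four_013_ten
  have := h _ S hS hfull
  omega

/-- **`ν(5,3) = 14` EXACT**: `StampLawAt 5 3 14 ∧ ¬ StampLawAt 5 3 13` (ceiling `stampLawAt_five_three`, floor
`fullyRealisable_five_014_fourteen`). [folklore] -/
theorem nu_five_three_exact : StampLawAt 5 3 14 ∧ ¬ StampLawAt 5 3 13 := by
  refine ⟨stampLawAt_five_three, fun h => ?_⟩
  obtain ⟨S, hS, hfull, hdeg⟩ := fullyRealisable_five_014_fourteen
  have := h _ S hS hfull
  omega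

/-- The `K = 3` stamp column for `1 ≤ m ≤ 5` in one line: every ceiling `n(m,2) ∈ {2, 4, 7, 10, 14}` is attained and sharp. [folklore] -/
theorem nu_K_three_small_exact :
    (StampLawAt 1 3 2 ∧ ¬ StampLawAt 1 3 1) ∧ (StampLawAt 2 3 4 ∧ ¬ StampLawAt 2 3 3) ∧ (StampLawAt 3 3 7 ∧ ¬ StampLawAt 3 3 6) ∧
      (StampLawAt 4 3 10 ∧ ¬ StampLawAt 4 3 9) ∧ (StampLawAt 5 3 14 ∧ ¬ StampLawAt 5 3 13) :=
  ⟨nu_one_three_exact, nu_two_three_exact, nu_three_three_exact, nu_four_three_exact, nu_five_three_exact⟩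

end Summit.ValiantsHypothesis.ValiantsHypothesis.Theorems.LacunarySymmetroidMatrixDescartes.FiniteSector
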